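import Literature.MathematicalPhysics.QuantumFieldTheory.Balaban1983to89.B8Thm4ZdGF3PMapGammaPrime
import Literature.MathematicalPhysics.QuantumFieldTheory.Balaban1983to89.B8Eq142KLevelLocalGammaPrime
import Literature.MathematicalPhysics.QuantumFieldTheory.Balaban1983to89.B8TowerBondsPrinted
import Literature.MathematicalPhysics.QuantumFieldTheory.Balaban1983to89.B8Ineq166Univ
import Literature.MathematicalPhysics.QuantumFieldTheory.Balaban1983to89.B8Ineq165AllLevels
import Literature.MathematicalPhysics.QuantumFieldTheory.Balaban1983to89.B8LeafModelZd3P2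
/-!
# `Balaban1983to89.B8Thm2ZdGF3P2MapGammaPrime` — [Balaban1985RegularSpaces] THEOREM 2 (p. 83) AS `B8.Thm2Printed` ON ANY INDEX-MAPPED `Ω₀ = ℤᵈ` SUB-FAMILY OF THE
# EDITION-δ₂ P-CARRIER `B8LeafModelZd3P2.zdGF3P₂` ∕ `zdGF3HP₂` ((1.36)'s Hölder member on `Ω_j × Ω_j` pairs, dag-n05-d g11 p599986) OVER THE γ′ SOCKET FAMILY OF RECORD
# — the (D5₂) item of dag-n05-d's DESIGN «P₂C» (cell bus 2026-08-28 03:12Z): the TOKEN IMAGE `zdGF3(H)P ↦ zdGF3(H)P₂` of this seat's g0 `B8Thm2ZdGF3PMapGammaPrime`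
# (p595790), same proof member by member; Theorem 4's body is the δ₁ one (`thm4Body_zdGF3HP_mapJ_γ'`, C136-free — `thm4Body_zdGF3P₂_iff` is `Iff.rfl`),
# PROPOSITION 3 on the image family `zdGF3P₂ ∘ ι` (dag-n05-d's D3₂ `B8Prop3PrintedZdGF3P2Gamma.prop3Printed_zdGF3P₂_map_γ`) is the hypothesis `hP3` whose
# both-points (1.36) is passed through to Theorem 2's conclusion

statement-level skeleton of published theorems with citation tags; proofs where landed; nothing here is a claim about the Yang–Mills mass gap.
T. Bałaban, *Spaces of regular gauge field configurations on a lattice and gauge fixing conditions*, Commun. Math. Phys. **99** (1985) 75–102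
`[Balaban1985RegularSpaces]` ("B8"; journal page = PDF page + 74): Thm 2 p. 83, (1.36) p. 82, Prop. 3 p. 87, Thm 4 p. 88, (1.65)–(1.67) pp. 87–88, p. 77.
[4] = `[Balaban1985BackgroundPropagators]`, (3.40) p. 397 (the Hölder seminorm of a function on a domain — both points in the domain).

## WHY THIS FILE (cell `pub-ymgap`, HUMAN RULING D-0062 ∕ D-0149; seat `pub-ymgap-dag-n05-w2` g2, WIDTH SEAT 2 of 4 on NODE n05 = [B8]; count-neutral)

dag-n05-d g11's located narrowness №4: [4]'s suppliers deliver (1.36)'s Hölder line over pairs with BOTH points in `Ω_j` (dag-n06-b's `SockB9P3H2`), n05-w1's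
`zdGF3P` typed it FIRST-point; the cure of record is the δ₂ carrier (p599986) and DESIGN «P₂C» re-pins the N05 slot on it.  Theorem 2 READS (1.36) (conclusion of
the existence clause, hypothesis of the uniqueness clause), so it has no `Iff.rfl` transfer: THIS FILE re-runs g0's proof on the δ₂ carrier — ★★
`thm2Printed_zdGF3HP₂_mapJ_γ'` — where (1.36) enters only through Proposition 3's conclusion (`hP3` on `zdGF3P₂ ∘ ι`) and leaves through Theorem 2's, and the
uniqueness clause reads (1.36)'s first member only (`log` bound ⇒ (1.62) for Theorem 4's uniqueness), unchanged between editions.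

## HONEST SCOPE

An assembly BY NAME; NO estimate proved anew (the arithmetic of the shifted pair and of (1.61) at `B₈` only); the four sourced sockets, the zero-source
triple, the tower laws and PROPOSITION 3 on the δ₂ carrier are HYPOTHESES (A6: providers = dag-n05-w4's γ′ chain modulo [4]'s letters; `hP3` = dag-n05-d's D3₂
modulo the both-points b9 socket `SockB9P3H2`, supplied by dag-n06-b's δ₂ files modulo [4]'s letters; m ≥ 1 = N06 content, OPEN; no joint-satisfiability claim).
`d, L ≥ 2`; `T_η ↦ ℤᵈ`; `≤` for print's `<`.  Count-neutral; N05 NOT discharged; no count claim (the chair's single count line is the only count); one finite `𝕋⁴`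
programme at fixed `ε`, Bałaban AS PRINTED; the Yang–Mills mass gap (Clay) is NOT proved by any of this — R4 closes the conditional finite-𝕋⁴ rung
`BalabanLadder.UV` only; nothing continuum ∕ ℝ⁴ ∕ OS.  No `sorry`, no `axiom`, no definition, no `instance`.  Unit `pub-ymgap-dag-n05-w2` (g2), 2026-08-28.

RELATED, NOT DUPLICATED: `B8Thm2ZdGF3PMapGammaPrime` (g0: the δ₁ edition), `B8LeafModelZd3P2` (dag-n05-d: carrier, USED), `B8Prop3PrintedZdGF3P2Gamma` (`hP3`'s shape).

[cite: Balaban1985RegularSpaces, Thm 2 (1.36)–(1.39) p.83, Thm 4 p.88, Prop. 3 p.87, (1.65)–(1.67) pp.87–88, (1.35)∕(1.37) p.82, p.77; Balaban1985BackgroundPropagators, (3.40) p.397]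
-/

noncomputable section
open NormedSpace
namespace Literature.MathematicalPhysics.QuantumFieldTheory.Balaban1983to89.B8Thm2ZdGF3P2MapGammaPrime

open Complex (I)
open MatrixLog B7Prop1Explicit B7Prop2Explicit B7Prop1Local B7Eq92Concrete
open B7Prop2Explicit (C0 c2')
open B7Prop3Flat (c3)
open B8Ineq132 (covDerivFwd InAk BondTouches)
open B8Eq119TwistedAxial (Restr129 InAx)
open B8Eq184Proof (gaugeExp cfgExp)
open B8Lemma1NonAbelian (mulCfg)
open B8Eq140Level (SideTouches)
open B8Eq146AExpansion (iEta)
open B7Prop4GeneralLevels (linCovIter)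
open B8Eq155JBound (Jcur wsup)
open B8ScaledSupNorm (bondNorm msup)
open B8Thm2LogB (blockTop)
open B8Ineq130 (tlo thi)
open B8Eq138LandauZd (IsLandau138W logCfg)
open B8Prop3GaugeFixedKLevel (mem_unitaryUnits_of_mgauge_eq mulCfg_eq_gaugeAct_of_mgauge_eq)
open B8Thm4AtLandau138 (mgauge_mgauge_inv)
open B8Thm4Windows (thm4_windows thm4_windows_extra)
open B8Thm4ExistsConcreteGamma (thm4_windows_γ)
open B8LeafModelZd (ZdIdx)
open B8LeafModelZd3 (mlogCfg mlogCfg_spec)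
open B8LeafModelZd3P (zdGF3P zdGF3HP)
open B8LeafModelZd3P2 (zdGF3P₂ zdGF3HP₂)
open B8TowerBondsPrinted (towerBondsP)
open B9SupplySockB9P3ZdBeta (CrossB)
open B8Ineq166Univ (norm_pert_sub_one_le_univ)
open B8Thm4ZdGF3PMapGammaPrime (thm4Body_zdGF3HP_mapJ_γ')
open B7Prop4GeneralLevels (logCovIter)

-- `Site` alone could resolve to the torus sites of `Setup.lean`; re-export the `ℤ^d` sites of `B7Prop1Explicit`.
export B7Prop1Explicit (Site)

variable {d : ℕ}

section Thm2

variable {𝔸 : Type} [CStarAlgebra 𝔸] [Nontrivial 𝔸]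

/-- ★★ **`B8.Thm2Printed` ON ANY INDEX-MAPPED `Ω₀ = ℤᵈ` SUB-FAMILY `ι : J → ZdIdx d L` OF THE EDITION-δ₂ P-CARRIER `zdGF3HP₂` (`toGFData` = `zdGF3P₂`'s by `rfl`; (1.36)'s Hölder member on `Ω_j × Ω_j` pairs), γ′ SOCKET FAMILY, ZERO SOURCE — the token image of this seat's g0 `thm2Printed_zdGF3HP_mapJ_γ'`** (Theorem 2, p. 83: «there exist constants
B₁, B₂(β₀), c₁ … exactly one gauge transformation u satisfying (1.29) and (1.36)–(1.39)»): this seat's `B8Thm2ZdGF3PGammaPrime.thm2Printed_zdGF3HP_univ_γ'` MEMBER BY MEMBER along `ι` (sockets, zero source and tower laws asked at `ι a` only), itself `B8LeafModelZd3PThm2Gamma.thm2Printed_zd3P_univ_γ`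
LINE BY LINE with the Theorem-4 step := `B8Thm4ZdGF3PMapGammaPrime.thm4Body_zdGF3HP_mapJ_γ'` (dag-n05-d's γ′ core at a zero source; constant `5dL·B₈`,
no bridge): for `d, L ≥ 2`, the leaf's `inp : B8.B9Inputs`, `B₀β > 0`, Prop. 5's radius `cu > 0`, the providers' threshold `cP > 0`, source constants
`γ′ ≥ 0`, `B₈ ≥ inp.B₀` with `5dL·inp.B₀ + 2γ′·inp.B₀ ≤ 5dL·B₈`, `2 ≤ 5dL·B₈`, any Hölder data `β, len` — MODULO the γ′ socket family of record
(`SP5base` ∕ `SP5` ∕ `SH59src` ∕ `SP5u`, sourced, one-end-point (1.35) antecedent), a zero source `(φ₀, hAdm₀, hLan₀)`, the members' tower laws, and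
PROPOSITION 3 on the image family `zdGF3P ∘ ι` (`hP3`, dag-n05-d's `prop3Printed_zdGF3P_map_γ`, any `C₂ ≤ 2097152(d+1)²L²`).  Proof: Theorem 4 at the shifted pair
`(α₀, α″ = 11d²(α₀ + α₁) + α₁)`; (1.66)₀ from (1.33)–(1.35) by (1.65) (`B8Ineq166Univ.norm_pert_sub_one_le_univ`, fed the box-form letter the
one-end-point letter implies); (1.37) AT PRINT's `α₁` by this seat's `B8Eq142KLevelLocalGammaPrime.H42_of_inAx_γ'` fed the member's letter verbatim;
(1.36)∕(1.39) by `hP3` at `(α₀, α″, α₂ := 5dL·B₈·(α₀ + α″))`, its (1.61) from the γ window at `B₈`; uniqueness = Theorem 4's ((1.36) at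
`B₁(α₀ + α₁) = 5dL·inp.B₀·(α₀ + α″) ≤ 5dL·B₈·(α₀ + α″)` is (1.62) there, (1.37) monotone in `α₁`).  Constants `B₁ = 5dL·inp.B₀·(1 + 11d²)`,
`B₂ = 5dL·B₀β·(1 + 11d²)`, ONE threshold.
[cite: Balaban1985RegularSpaces, Thm 2 (1.36)–(1.39) p.83, Thm 4 p.88, Prop. 3 p.87, (1.65)–(1.67) pp.87–88, (1.35)∕(1.37) p.82, p.77, Thm 8 (1.146) p.101] -/
theorem thm2Printed_zdGF3HP₂_mapJ_γ' (hd2 : 2 ≤ d) {L : ℕ} (hL : 2 ≤ L) {β : ℝ} {len : Site d → ℝ} (inp : B8.B9Inputs)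
    {B₀β cu cP C₂ : ℝ} (hB₀β : 0 < B₀β) (hcu : 0 < cu) (hcP : 0 < cP) (hC₂ : C₂ ≤ 2097152 * ((d : ℝ) + 1) ^ 2 * (L : ℝ) ^ 2)
    -- THE γ′ SOCKET FAMILY OF RECORD ALONG AN INDEX MAP `ι : J → ZdIdx d L` (dag-n05-d's `B8Thm4CoreZdGF3HPLanEGamma.thm4Core_zdGF3HP_map_lanE_γ'`,
    -- verbatim at `B₀ := inp.B₀`, `B₀′ := inp.B₀′`): source data `Φ, γ′, B₈, Adm a, LanF a` and the four sourced sockets AT `ι a` (one-end-point (1.35) antecedent)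
    {Φ : Type*} {γ' B₈ : ℝ} (hγ' : 0 ≤ γ') (hB₈ : 0 < B₈) (hB₀8 : inp.B₀ ≤ B₈) (hB : 2 ≤ 5 * (d : ℝ) * L * B₈)
    (hγB : 5 * (d : ℝ) * L * inp.B₀ + 2 * (γ' * inp.B₀) ≤ 5 * (d : ℝ) * L * B₈)
    {J : Type} (ι : J → ZdIdx d L)
    (Adm : J → Φ → (Site d → Fin d → 𝔸ˣ) → ℝ → ℝ → Prop)
    (LanF : J → (Site d → Fin d → 𝔸ˣ) → Φ → ℕ → (Site d → Fin d → 𝔸ˣ) → Prop)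
    (SP5base : ∀ a : J, ∀ α₀ α₁ : ℝ, 0 < α₀ → 0 < α₁ → α₀ + α₁ ≤ cP →
      ∀ U₀ U' : Site d → Fin d → 𝔸ˣ, (∀ x κ, U₀ x κ ∈ unitaryUnits 𝔸) → (∀ x κ, U' x κ ∈ unitaryUnits 𝔸) →
      ∀ φ : Φ, Adm a φ U₀ α₀ α₁ →
      InAk L (ι a).k (ι a).η α₀ (ι a).Ω U₀ → InAk L (ι a).k (ι a).η α₀ (ι a).Ω (mulCfg U' U₀) → (∀ m, m ≤ (ι a).k → InAx L m ((ι a).Λs m) U₀ (mulCfg U' U₀)) →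
      (∀ j, j ≤ (ι a).k → ∀ (z : Site d) (μ : Fin d),
        ((∀ x, InBox (tlo L z j) (thi L z j) x → x ∈ (ι a).Ω j) ∨ (∀ x, InBox (tlo L (z + e μ) j) (thi L (z + e μ) j) x → x ∈ (ι a).Ω j)) →
        ‖(avgIter L (mulCfg U' U₀) j z μ : 𝔸) - (avgIter L U₀ j z μ : 𝔸)‖ ≤ α₁) →
      (∀ b ∈ {b : Site d × Fin d | SideTouches ((ι a).Ω 0) b.1 b.2}, ‖((U' b.1 b.2 : 𝔸ˣ) : 𝔸) - 1‖ ≤ α₁) →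
      (∃ (v : Site d → 𝔸ˣ) (lam : Site d → 𝔸), (∀ x, v x ∈ unitaryUnits 𝔸) ∧ (∀ x, x ∉ (ι a).Ω 0 → v x = 1) ∧
        (∀ j, j ≤ 1 → ∀ b ∈ {b : Site d × Fin d | SideTouches ((ι a).Ω j) b.1 b.2}, (v b.1 : 𝔸) = ((gaugeExp lam b.1 : 𝔸ˣ) : 𝔸) ∧
        (v (b.1 + e b.2) : 𝔸) = ((gaugeExp lam (b.1 + e b.2) : 𝔸ˣ) : 𝔸)) ∧
        (∀ j, j ≤ 1 → ∀ b ∈ {b : Site d × Fin d | SideTouches ((ι a).Ω j) b.1 b.2},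
        ‖lam b.1‖ ≤ (8 * inp.B₀' * (5 * (d : ℝ) * L * B₈) * (α₀ + α₁)) ∧ ((L : ℝ) ^ j * (ι a).η) * ‖covDerivFwd (ι a).η U₀ b.2 lam b.1‖ ≤ (8 * inp.B₀' * (5 * (d : ℝ) * L * B₈) * (α₀ + α₁))) ∧
        LanF a U₀ φ 1 (mgauge U₀ v⁻¹ U') ∧ Restr129 L 1 ((ι a).Λs 1) U₀ ((1 : Site d → 𝔸ˣ) * v)))
    (SP5 : ∀ a : J, ∀ α₀ α₁ : ℝ, 0 < α₀ → 0 < α₁ → α₀ + α₁ ≤ cP →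
      ∀ U₀ U' : Site d → Fin d → 𝔸ˣ, (∀ x κ, U₀ x κ ∈ unitaryUnits 𝔸) → (∀ x κ, U' x κ ∈ unitaryUnits 𝔸) →
      ∀ φ : Φ, Adm a φ U₀ α₀ α₁ →
      InAk L (ι a).k (ι a).η α₀ (ι a).Ω U₀ → InAk L (ι a).k (ι a).η α₀ (ι a).Ω (mulCfg U' U₀) → (∀ m, m ≤ (ι a).k → InAx L m ((ι a).Λs m) U₀ (mulCfg U' U₀)) →
      (∀ j, j ≤ (ι a).k → ∀ (z : Site d) (μ : Fin d),
        ((∀ x, InBox (tlo L z j) (thi L z j) x → x ∈ (ι a).Ω j) ∨ (∀ x, InBox (tlo L (z + e μ) j) (thi L (z + e μ) j) x → x ∈ (ι a).Ω j)) →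
        ‖(avgIter L (mulCfg U' U₀) j z μ : 𝔸) - (avgIter L U₀ j z μ : 𝔸)‖ ≤ α₁) →
      (∀ b ∈ {b : Site d × Fin d | SideTouches ((ι a).Ω 0) b.1 b.2}, ‖((U' b.1 b.2 : 𝔸ˣ) : 𝔸) - 1‖ ≤ α₁) →
      (∀ m, 1 ≤ m → m < (ι a).k → ∀ (u₁ : Site d → 𝔸ˣ) (U₁ : Site d → Fin d → 𝔸ˣ) (A : Site d → Fin d → 𝔸),
        (∀ x, u₁ x ∈ unitaryUnits 𝔸) → (∀ x, x ∉ (ι a).Ω 0 → u₁ x = 1) → mgauge U₀ u₁ U₁ = U' → Restr129 L m ((ι a).Λs m) U₀ u₁ →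
        LanF a U₀ φ m U₁ →
        (∀ j, j ≤ m → ∀ b ∈ {b : Site d × Fin d | SideTouches ((ι a).Ω j) b.1 b.2},
        U₁ b.1 b.2 = cfgExp (ι a).η A b.1 b.2 ∧ IsSelfAdjoint (A b.1 b.2) ∧ ‖A b.1 b.2‖ ≤ (5 * (d : ℝ) * L * B₈ * (α₀ + α₁)) * ((L : ℝ) ^ j * (ι a).η)⁻¹) →
        ∃ (v : Site d → 𝔸ˣ) (lam : Site d → 𝔸), (∀ x, v x ∈ unitaryUnits 𝔸) ∧ (∀ x, x ∉ (ι a).Ω 0 → v x = 1) ∧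
        (∀ j, j ≤ m + 1 → ∀ b ∈ {b : Site d × Fin d | SideTouches ((ι a).Ω j) b.1 b.2}, (v b.1 : 𝔸) = ((gaugeExp lam b.1 : 𝔸ˣ) : 𝔸) ∧
        (v (b.1 + e b.2) : 𝔸) = ((gaugeExp lam (b.1 + e b.2) : 𝔸ˣ) : 𝔸)) ∧
        (∀ j, j ≤ m + 1 → ∀ b ∈ {b : Site d × Fin d | SideTouches ((ι a).Ω j) b.1 b.2},
        ‖lam b.1‖ ≤ (8 * inp.B₀' * (5 * (d : ℝ) * L * B₈) * (α₀ + α₁)) ∧ ((L : ℝ) ^ j * (ι a).η) * ‖covDerivFwd (ι a).η U₀ b.2 lam b.1‖ ≤ (8 * inp.B₀' * (5 * (d : ℝ) * L * B₈) * (α₀ + α₁))) ∧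
        LanF a U₀ φ (m + 1) (mgauge U₀ v⁻¹ U₁) ∧ Restr129 L (m + 1) ((ι a).Λs (m + 1)) U₀ (u₁ * v)))
    (SH59src : ∀ a : J, ∀ α₀ α₁ : ℝ, 0 < α₀ → 0 < α₁ → α₀ + α₁ ≤ cP →
      ∀ U₀ U' : Site d → Fin d → 𝔸ˣ, (∀ x κ, U₀ x κ ∈ unitaryUnits 𝔸) → (∀ x κ, U' x κ ∈ unitaryUnits 𝔸) →
      ∀ φ : Φ, Adm a φ U₀ α₀ α₁ →
      InAk L (ι a).k (ι a).η α₀ (ι a).Ω U₀ → InAk L (ι a).k (ι a).η α₀ (ι a).Ω (mulCfg U' U₀) → (∀ m, m ≤ (ι a).k → InAx L m ((ι a).Λs m) U₀ (mulCfg U' U₀)) →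
      (∀ j, j ≤ (ι a).k → ∀ (z : Site d) (μ : Fin d),
        ((∀ x, InBox (tlo L z j) (thi L z j) x → x ∈ (ι a).Ω j) ∨ (∀ x, InBox (tlo L (z + e μ) j) (thi L (z + e μ) j) x → x ∈ (ι a).Ω j)) →
        ‖(avgIter L (mulCfg U' U₀) j z μ : 𝔸) - (avgIter L U₀ j z μ : 𝔸)‖ ≤ α₁) →
      (∀ b ∈ {b : Site d × Fin d | SideTouches ((ι a).Ω 0) b.1 b.2}, ‖((U' b.1 b.2 : 𝔸ˣ) : 𝔸) - 1‖ ≤ α₁) →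
      (∀ m, 1 ≤ m → m ≤ (ι a).k → ∀ (u : Site d → 𝔸ˣ) (W : Site d → Fin d → 𝔸ˣ) (A' : Site d → Fin d → 𝔸),
        (∀ x, u x ∈ unitaryUnits 𝔸) → mgauge U₀ u W = U' → Restr129 L m ((ι a).Λs m) U₀ u → LanF a U₀ φ m W →
        (∀ y τ, IsSelfAdjoint (A' y τ)) →
        (∀ j, j ≤ m → ∀ y τ, SideTouches ((ι a).Ω j) y τ →
        W y τ = cfgExp (ι a).η A' y τ ∧ ‖A' y τ‖ ≤ (2 * (L * (5 * (d : ℝ) * L * B₈ * (α₀ + α₁))) + 8 * (8 * inp.B₀' * (5 * (d : ℝ) * L * B₈) * (α₀ + α₁))) * ((L : ℝ) ^ j * (ι a).η)⁻¹) →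
        (∀ y τ, (∀ j, j ≤ m → ¬ SideTouches ((ι a).Ω j) y τ) → A' y τ = 0) →
        msup L m (ι a).η (-(1 : ℝ)) (fun j (b : Site d × Fin d) => SideTouches ((ι a).Ω j) b.1 b.2) (fun b => A' b.1 b.2)
        ≤ inp.B₀ * (bondNorm L m (ι a).η (-(3 : ℝ)) (ι a).Ω (fun x μ => Jcur (ι a).η U₀ A' μ x)
        + wsup 1 (fun p : {p : ℕ × (Site d × Fin d) // p.1 ≤ m ∧ p.2 ∈ towerBondsP L (ι a).Ω ((ι a).Λs m) p.1} =>
        linCovIter L U₀ (iEta (ι a).η A') p.1.1 p.1.2.1 p.1.2.2)) + γ' * inp.B₀ * (α₀ + α₁) ∧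
        msup L m (ι a).η (-(2 : ℝ)) (fun j (t : Fin d × Fin d × Site d) => SideTouches ((ι a).Ω j) t.2.2 t.2.1)
        (fun t => covDerivFwd (ι a).η U₀ t.1 (fun z => A' z t.2.1) t.2.2)
        ≤ inp.B₀ * (bondNorm L m (ι a).η (-(3 : ℝ)) (ι a).Ω (fun x μ => Jcur (ι a).η U₀ A' μ x)
        + wsup 1 (fun p : {p : ℕ × (Site d × Fin d) // p.1 ≤ m ∧ p.2 ∈ towerBondsP L (ι a).Ω ((ι a).Λs m) p.1} =>
        linCovIter L U₀ (iEta (ι a).η A') p.1.1 p.1.2.1 p.1.2.2)) + γ' * inp.B₀ * (α₀ + α₁)))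
    (SP5u : ∀ a : J, ∀ α₀ α₁ : ℝ, 0 < α₀ → 0 < α₁ → α₀ + α₁ ≤ cP →
      ∀ U₀ U' : Site d → Fin d → 𝔸ˣ, (∀ x κ, U₀ x κ ∈ unitaryUnits 𝔸) → (∀ x κ, U' x κ ∈ unitaryUnits 𝔸) →
      ∀ φ : Φ, Adm a φ U₀ α₀ α₁ →
      InAk L (ι a).k (ι a).η α₀ (ι a).Ω U₀ → InAk L (ι a).k (ι a).η α₀ (ι a).Ω (mulCfg U' U₀) → (∀ m, m ≤ (ι a).k → InAx L m ((ι a).Λs m) U₀ (mulCfg U' U₀)) →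
      (∀ j, j ≤ (ι a).k → ∀ (z : Site d) (μ : Fin d),
        ((∀ x, InBox (tlo L z j) (thi L z j) x → x ∈ (ι a).Ω j) ∨ (∀ x, InBox (tlo L (z + e μ) j) (thi L (z + e μ) j) x → x ∈ (ι a).Ω j)) →
        ‖(avgIter L (mulCfg U' U₀) j z μ : 𝔸) - (avgIter L U₀ j z μ : 𝔸)‖ ≤ α₁) →
      (∀ b ∈ {b : Site d × Fin d | SideTouches ((ι a).Ω 0) b.1 b.2}, ‖((U' b.1 b.2 : 𝔸ˣ) : 𝔸) - 1‖ ≤ α₁) →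
      ∀ u₁ : Site d → 𝔸ˣ, (∀ x, u₁ x ∈ unitaryUnits 𝔸) → (∀ x, x ∉ (ι a).Ω 0 → u₁ x = 1) → Restr129 L (ι a).k ((ι a).Λs (ι a).k) U₀ u₁ →
      LanF a U₀ φ (ι a).k (mgauge U₀ u₁⁻¹ U') →
      (∃ A₁ : Site d → Fin d → 𝔸, ∀ j, j ≤ (ι a).k → ∀ (x : Site d) (κ : Fin d), SideTouches ((ι a).Ω j) x κ →
        mgauge U₀ u₁⁻¹ U' x κ = cfgExp (ι a).η A₁ x κ ∧ ‖A₁ x κ‖ ≤ (5 * (d : ℝ) * L * B₈ * (α₀ + α₁)) * ((L : ℝ) ^ j * (ι a).η)⁻¹) →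
      ∀ (v w : Site d → 𝔸ˣ) (lam mu : Site d → 𝔸),
      (∀ x, ((gaugeExp lam x : 𝔸ˣ) : 𝔸) = ((v x : 𝔸ˣ) : 𝔸) ∧ IsSelfAdjoint (lam x) ∧ ‖lam x‖ < cu) → (∀ x, x ∉ (ι a).Ω 0 → lam x = 0) →
      (∀ j, j ≤ (ι a).k → ∀ b ∈ {b : Site d × Fin d | SideTouches ((ι a).Ω j) b.1 b.2}, ((L : ℝ) ^ j * (ι a).η) * ‖covDerivFwd (ι a).η U₀ b.2 lam b.1‖ < cu) →
      (∀ x, ((gaugeExp mu x : 𝔸ˣ) : 𝔸) = ((w x : 𝔸ˣ) : 𝔸) ∧ IsSelfAdjoint (mu x) ∧ ‖mu x‖ < cu) → (∀ x, x ∉ (ι a).Ω 0 → mu x = 0) →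
      (∀ j, j ≤ (ι a).k → ∀ b ∈ {b : Site d × Fin d | SideTouches ((ι a).Ω j) b.1 b.2}, ((L : ℝ) ^ j * (ι a).η) * ‖covDerivFwd (ι a).η U₀ b.2 mu b.1‖ < cu) →
      LanF a U₀ φ (ι a).k (mgauge U₀ v⁻¹ (mgauge U₀ u₁⁻¹ U')) → Restr129 L (ι a).k ((ι a).Λs (ι a).k) U₀ (u₁ * v) →
      LanF a U₀ φ (ι a).k (mgauge U₀ w⁻¹ (mgauge U₀ u₁⁻¹ U')) → Restr129 L (ι a).k ((ι a).Λs (ι a).k) U₀ (u₁ * w) →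
      ∀ x, v x = w x)
    -- the ZERO SOURCE (admitted everywhere; its level-`k` gauge condition = the carrier's (1.38) `Landau`)
    (φ₀ : Φ) (hAdm₀ : ∀ a : J, ∀ α₀ α₁ : ℝ, 0 < α₀ → 0 < α₁ → ∀ U₀ : Site d → Fin d → 𝔸ˣ, (∀ x κ, U₀ x κ ∈ unitaryUnits 𝔸) →
      Adm a φ₀ U₀ α₀ α₁)
    (hLan₀ : ∀ a : J, ∀ U₀ W : Site d → Fin d → 𝔸ˣ,
      LanF a U₀ φ₀ (ι a).k W ↔ IsLandau138W L (ι a).k (ι a).η ((ι a).Ω 0) ((ι a).Λs (ι a).k) U₀ W)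
    -- the image lies in the `Ω₀ = ℤᵈ` members; their tower laws at every truncation (`IdxB8Sub.tower_all` at NODE 00's law members)
    (hΩ : ∀ a : J, (ι a).Ω 0 = Set.univ)
    (htw : ∀ a : J, ∀ m, m ≤ (ι a).k → ∀ j, j ≤ m → ∀ y ∈ (ι a).Λs m j, ∀ x, InBox (tlo L y j) (thi L y j) x → x ∈ (ι a).Ω j)
    -- PROPOSITION 3 AS PRINTED on the IMAGE family (dag-n05-d's `prop3Printed_zdGF3P_map_γ (ι)`, A6: not over all `ZdIdx`), any `C₂ ≤ 2097152(d+1)²L²`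
    (hP3 : B8.Prop3Printed d (L : ℝ) C₂ inp B₀β (fun a : J => (zdGF3P₂ 𝔸 L β len (ι a)).toGFData2)) :
    B8.Thm2Printed (fun a : J => (zdGF3HP₂ 𝔸 L β len (ι a)).toGFData) := by
  have hL1 : 1 ≤ L := le_trans (by norm_num) hL
  have hd1 : 1 ≤ d := le_trans (by norm_num) hd2
  have hL' : (1 : ℝ) ≤ L := by exact_mod_cast hL1
  have hd' : (1 : ℝ) ≤ d := by exact_mod_cast hd1
  have hB₀ : 0 < inp.B₀ := inp.B₀_pos
  have hB₀' : 0 < inp.B₀' := inp.B₀'_pos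
  -- Theorem 4's constant `B₈ ≥ B₀`
  have hKB₀ : 0 < B₈ := hB₈
  have hBK : 2 ≤ 5 * (d : ℝ) * L * B₈ := hB
  -- the two instances, the windows
  obtain ⟨c4, hc4, H4⟩ := thm4Body_zdGF3HP_mapJ_γ' (𝔸 := 𝔸) (β := β) (len := len) hd2 hL hB₀ hB₀' hcu hcP hγ' hB₈ hB₀8 hB hγB
    ι Adm LanF SP5base SP5 SH59src SP5u φ₀ hAdm₀ hLan₀
  obtain ⟨c3, hc3, H3⟩ := hP3
  obtain ⟨cw, hcw, hw⟩ := thm4_windows_γ hd1 hL1 hKB₀ hB₀' hBK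
  obtain ⟨cw', hcw', hw'⟩ := thm4_windows_extra (d := d) hL1
  -- constants
  set D : ℝ := 1 + 11 * (d : ℝ) ^ 2 with hD_def
  have hD1 : 1 ≤ D := le_add_of_nonneg_right (by positivity)
  have hD0 : 0 < D := lt_of_lt_of_le one_pos hD1
  have hDne : D ≠ 0 := hD0.ne'
  have hK₁ : 0 < 5 * (d : ℝ) * L * inp.B₀ := by positivity
  have hK₂ : 0 < 5 * (d : ℝ) * L * B₀β := by positivity
  set B₁ : ℝ := 5 * (d : ℝ) * L * inp.B₀ * D with hB₁_def
  set B₂ : ℝ := 5 * (d : ℝ) * L * B₀β * D with hB₂_def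
  have hB₁0 : 0 < B₁ := mul_pos hK₁ hD0
  have hB₂0 : 0 < B₂ := mul_pos hK₂ hD0
  have hK₁D : 0 < 5 * (d : ℝ) * L * B₈ * D := mul_pos (by positivity) hD0
  have hK₁Dne : 5 * (d : ℝ) * L * B₈ * D ≠ 0 := hK₁D.ne'
  -- the threshold: the shifted pair must fit every window; Prop 3's three smallness conditions; the (1.65) window
  set cT : ℝ := min (min (c4 / D) (min (cw / D) (cw' / D)))
    (min (min (c3 / D) (c3 / (5 * (d : ℝ) * L * B₈ * D))) (1 / (6 * D))) with hcT_def
  have hcT : 0 < cT :=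
    lt_min (lt_min (div_pos hc4 hD0) (lt_min (div_pos hcw hD0) (div_pos hcw' hD0)))
      (lt_min (lt_min (div_pos hc3 hD0) (div_pos hc3 hK₁D)) (by positivity))
  refine ⟨B₁, B₂, cT, hB₁0, hB₂0, hcT, ?_⟩
  intro i α₀ α₁ hα₀ hα₁ hs U₀ P hInA hReg hInAAx havg
  have hS0 : 0 < α₀ + α₁ := add_pos hα₀ hα₁
  -- unpack the thresholds
  have hle : ∀ {c : ℝ}, cT ≤ c / D → D * (α₀ + α₁) ≤ c := by
    intro c hc
    have h1 : α₀ + α₁ ≤ c / D := hs.trans hc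
    calc D * (α₀ + α₁) ≤ D * (c / D) := mul_le_mul_of_nonneg_left h1 hD0.le
      _ = c := by field_simp
  have hs4 : D * (α₀ + α₁) ≤ c4 := hle ((min_le_left _ _).trans (min_le_left _ _))
  have hsw : D * (α₀ + α₁) ≤ cw := hle ((min_le_left _ _).trans ((min_le_right _ _).trans (min_le_left _ _)))
  have hsw' : D * (α₀ + α₁) ≤ cw' := hle ((min_le_left _ _).trans ((min_le_right _ _).trans (min_le_right _ _)))
  have hs3 : D * (α₀ + α₁) ≤ c3 := hle ((min_le_right _ _).trans ((min_le_left _ _).trans (min_le_left _ _)))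
  have hs3' : 5 * (d : ℝ) * L * B₈ * D * (α₀ + α₁) ≤ c3 := by
    have h1 : α₀ + α₁ ≤ c3 / (5 * (d : ℝ) * L * B₈ * D) :=
      hs.trans ((min_le_right _ _).trans ((min_le_left _ _).trans (min_le_right _ _)))
    calc 5 * (d : ℝ) * L * B₈ * D * (α₀ + α₁) ≤ 5 * (d : ℝ) * L * B₈ * D * (c3 / (5 * (d : ℝ) * L * B₈ * D)) :=
        mul_le_mul_of_nonneg_left h1 hK₁D.le
      _ = c3 := by field_simp
  have hs6 : D * (α₀ + α₁) ≤ 1 / 6 := by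
    have h1 : α₀ + α₁ ≤ 1 / (6 * D) := hs.trans ((min_le_right _ _).trans (min_le_right _ _))
    calc D * (α₀ + α₁) ≤ D * (1 / (6 * D)) := mul_le_mul_of_nonneg_left h1 hD0.le
      _ = 1 / 6 := by field_simp
  -- the shifted pair `(α₀, α″)`
  set α'' : ℝ := 11 * (d : ℝ) ^ 2 * (α₀ + α₁) + α₁ with hα''_def
  have h11 : 0 ≤ 11 * (d : ℝ) ^ 2 * (α₀ + α₁) := by positivity
  have h11' : 0 ≤ 11 * (d : ℝ) ^ 2 * α₁ := by positivity
  have hα'' : 0 < α'' := by rw [hα''_def]; linarith only [h11, hα₁]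
  have hsum : α₀ + α'' = D * (α₀ + α₁) := by simp only [hα''_def, hD_def]; ring
  have hα₁'' : α₁ ≤ α'' := by rw [hα''_def]; linarith only [h11]
  have h165 : 11 * (d : ℝ) ^ 2 * α₀ + α₁ ≤ α'' := by rw [hα''_def]; linarith only [h11']
  -- windows at the shifted pair
  obtain ⟨g5, g6, g7, g9, g10, -, g14⟩ :=
    hw α₀ α'' hα₀ hα'' (hsum ▸ hsw) (5 * (d : ℝ) * L * B₈ * (α₀ + α'')) (8 * inp.B₀' * (5 * (d : ℝ) * L * B₈) * (α₀ + α'')) rfl rfl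
  obtain ⟨w19, -⟩ := hw' α₀ α'' hα₀ hα'' (hsum ▸ hsw')
  have hsmall₁ : (d : ℝ) * L * α₁ ≤ 1 / 8 := (mul_le_mul_of_nonneg_left hα₁'' (by positivity)).trans w19
  -- the un-scaled windows `C₀α₀ ≤ 1/3`, `2α₀ ≤ c₂′` for (1.65) (from the γ ones, `α₀ ≤ L²α₀`)
  have hL2 : (1 : ℝ) ≤ (L : ℝ) ^ 2 := one_le_pow₀ hL'
  have hαL2 : α₀ ≤ (L : ℝ) ^ 2 * α₀ := le_mul_of_one_le_left hα₀.le hL2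
  have w5 : C0 d * α₀ ≤ 1 / 3 := (mul_le_mul_of_nonneg_left hαL2 (C0_pos d).le).trans g5
  have hα2 : 2 * α₀ ≤ c2' d L := by linarith only [g6, hα₀, hαL2]
  -- the data
  obtain ⟨hP1, h34, hAx⟩ := hInAAx
  subst hP1
  -- the box-form letter from the member's one-end-point letter (both end-blocks inside ⇒ the first is)
  have havgBox : ∀ j, j ≤ (ι i).k → ∀ (z : Site d) (μ : Fin d), (∀ x, InBox (loK L j z) (bondHiK L j z μ) x → x ∈ (ι i).Ω j) →
      ‖(avgIter L (mulCfg P.2.1 P.1.1) j z μ : 𝔸) - (avgIter L P.1.1 j z μ : 𝔸)‖ ≤ α₁ :=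
    fun j hj z μ hg => havg j hj z μ (Or.inl fun x hx => hg x (B8Ineq165AllLevels.inBox_bondBox_of_inBox_block_fst L j z μ hx))
  -- (1.66)₀ on all bonds (Ω₀ = ℤᵈ): (1.65)
  have hpart' : ∀ x : Site d, ∃ j, j ≤ (ι i).k ∧ ∃ y ∈ (ι i).Λs (ι i).k j, InBox (tlo L y j) (thi L y j) x := by
    intro x
    have hx : x ∈ (ι i).Ω 0 := by rw [hΩ i]; trivial
    exact (ι i).hpart x hx
  have hsm : 11 * (d : ℝ) ^ 2 * α₀ + α₁ ≤ 1 / 6 := by linarith only [h165, hα₀, hsum, hs6]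
  have h66 : ∀ b ∈ {b : Site d × Fin d | SideTouches ((ι i).Ω 0) b.1 b.2}, ‖((P.2.1 b.1 b.2 : 𝔸ˣ) : 𝔸) - 1‖ ≤ α'' := by
    intro b _
    have h := norm_pert_sub_one_le_univ hd1 hL (ι i).k (η := (ι i).η) P.1.2 P.2.2 hα₀ w5 hα2 hα₁.le hsm
      (ι i).Ω (ι i).hΩ ((ι i).Λs (ι i).k) (ι i).htower hpart' hInA h34 (hAx (ι i).k le_rfl) havgBox b.1 b.2
    exact h.trans h165
  have h166 : (zdGF3P₂ 𝔸 L β len (ι i)).avgClose166 α'' P.1 P :=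
    ⟨fun j hj z μ hb => (havg j hj z μ hb).trans hα₁'', h66⟩
  -- THEOREM 4 at the shifted pair
  obtain ⟨u, hR, ⟨h137'', hLan, h162⟩, huniq⟩ :=
    H4 i (htw i) () α₀ α'' hα₀ hα'' (hsum ▸ hs4) P.1 P hInA hReg ⟨rfl, h34, hAx⟩ h166
  -- (1.37) at the ORIGINAL α₁: the (1.42) lemma on the canonical exponent of the gauge-fixed field
  have hcs0 : 0 ≤ 5 * (d : ℝ) * L * B₈ * (α₀ + α'') := by positivity
  have hKS0 : 0 ≤ 2 * (L * (5 * (d : ℝ) * L * B₈ * (α₀ + α''))) + 8 * (8 * inp.B₀' * (5 * (d : ℝ) * L * B₈) * (α₀ + α'')) := by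
    positivity
  have hcK : 5 * (d : ℝ) * L * B₈ * (α₀ + α'') ≤
      2 * (L * (5 * (d : ℝ) * L * B₈ * (α₀ + α''))) + 8 * (8 * inp.B₀' * (5 * (d : ℝ) * L * B₈) * (α₀ + α'')) := by
    have h₁ : (1 : ℝ) * (5 * (d : ℝ) * L * B₈ * (α₀ + α'')) ≤ L * (5 * (d : ℝ) * L * B₈ * (α₀ + α'')) :=
      mul_le_mul_of_nonneg_right hL' hcs0
    have h₂ : 0 ≤ 8 * (8 * inp.B₀' * (5 * (d : ℝ) * L * B₈) * (α₀ + α'')) := by positivity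
    linarith only [h₁, h₂, hcs0]
  have h16KS : 16 * (2 * (L * (5 * (d : ℝ) * L * B₈ * (α₀ + α''))) + 8 * (8 * inp.B₀' * (5 * (d : ℝ) * L * B₈) * (α₀ + α''))) ≤ 1 := by
    have h₁ := mul_le_mul_of_nonneg_right hL' hKS0
    linarith only [g7, h₁]
  have hc16 : 16 * (5 * (d : ℝ) * L * B₈ * (α₀ + α'')) ≤ 1 := by linarith only [h16KS, hcK, hKS0]
  have hu : ∀ x, u.1 x ∈ unitaryUnits 𝔸 := u.2.1
  have hW : mgauge P.1.1 u.1 (mgauge P.1.1 u.1⁻¹ P.2.1) = P.2.1 := mgauge_mgauge_inv P.1.1 P.2.1 u.1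
  have hWu : ∀ x κ, mgauge P.1.1 u.1⁻¹ P.2.1 x κ ∈ unitaryUnits 𝔸 := mem_unitaryUnits_of_mgauge_eq P.1.2 P.2.2 hu hW
  have hWA : ∀ j, j ≤ (ι i).k → ∀ y τ, SideTouches ((ι i).Ω j) y τ →
      mgauge P.1.1 u.1⁻¹ P.2.1 y τ = cfgExp (ι i).η (logCfg (ι i).η (mgauge P.1.1 u.1⁻¹ P.2.1)) y τ ∧
        ‖logCfg (ι i).η (mgauge P.1.1 u.1⁻¹ P.2.1) y τ‖ ≤ (5 * (d : ℝ) * L * B₈ * (α₀ + α'')) * ((L : ℝ) ^ j * (ι i).η)⁻¹ :=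
    fun j hj y τ h => ⟨(h162 j hj (y, τ) h).1, (h162 j hj (y, τ) h).2.2⟩
  obtain ⟨hA'sa, hA'eq, hA'zero⟩ := mlogCfg_spec (ι i).hη hL1 (ι i).k P.1.1 hWu hcs0 hc16 (ι i).Ω hWA
  set A' := mlogCfg (ι i).k (ι i).η (ι i).Ω (mgauge P.1.1 u.1⁻¹ P.2.1) with hA'_def
  have hA'bd : ∀ j, j ≤ (ι i).k → ∀ y τ, SideTouches ((ι i).Ω j) y τ →
      mgauge P.1.1 u.1⁻¹ P.2.1 y τ = cfgExp (ι i).η A' y τ ∧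
        ‖A' y τ‖ ≤ (2 * (L * (5 * (d : ℝ) * L * B₈ * (α₀ + α''))) + 8 * (8 * inp.B₀' * (5 * (d : ℝ) * L * B₈) * (α₀ + α''))) *
          ((L : ℝ) ^ j * (ι i).η)⁻¹ := by
    intro j hj y τ h
    obtain ⟨hAA, hWexp⟩ := hA'eq j hj y τ h
    refine ⟨hWexp, ?_⟩
    rw [hAA]
    have hη0 : 0 ≤ (ι i).η := (ι i).hη.le
    exact ((hWA j hj y τ h).2).trans (mul_le_mul_of_nonneg_right hcK (by positivity))
  obtain ⟨hboxP, hclassP⟩ := B8TowerBondsPrinted.ZdIdx.towerBondsP_laws (ι i)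
  have h137 : (zdGF3P₂ 𝔸 L β len (ι i)).C137 α₁ P.1 ((zdGF3P₂ 𝔸 L β len (ι i)).act P u) :=
    B8Eq142KLevelLocalGammaPrime.H42_of_inAx_γ' hd2 (ι i).hη hL (ι i).k P.1.2 hα₀ hα₁ hKS0 g5 g6 g7 g9 g10 hsmall₁ (ι i).Ω (ι i).hΩ (ι i).Λs
      (fun m j => towerBondsP L (ι i).Ω ((ι i).Λs m) j) hboxP hclassP hInA h34 hAx (fun j hj z μ hg => havg j hj z μ hg)
      (fun m W => IsLandau138W L m (ι i).η ((ι i).Ω 0) ((ι i).Λs m) P.1.1 W) (ι i).k (ι i).hk le_rfl (ι i).htower u.1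
      (mgauge P.1.1 u.1⁻¹ P.2.1) A' hu hW hR hLan hA'sa hA'bd hA'zero
  -- PROPOSITION 3 at (α₀, α″, α₂ := c⋆″) for the gauge-fixed field
  have hSD : α₀ + α₁ ≤ D * (α₀ + α₁) := le_mul_of_one_le_left hS0.le hD1
  have hα₀3 : α₀ ≤ c3 := by linarith only [hα₁, hSD, hs3]
  have hα''3 : α'' ≤ c3 := by linarith only [hα₀, hsum, hs3]
  have hcs3 : 5 * (d : ℝ) * L * B₈ * (α₀ + α'') ≤ c3 := by
    rw [hsum, ← mul_assoc]; exact hs3'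
  have hcspos : 0 < 5 * (d : ℝ) * L * B₈ * (α₀ + α'') := by positivity
  have h61 : 2 * (5 * (d : ℝ) * L * B₈ * (α₀ + α'')) ^ 2 + 20 * d * α₀ * (5 * (d : ℝ) * L * B₈ * (α₀ + α'')) +
      2 * C₂ * (5 * (d : ℝ) * L * B₈ * (α₀ + α'')) ^ 2 ≤ α₀ + α'' := by
    set c := 5 * (d : ℝ) * L * B₈ * (α₀ + α'') with hc
    set K := 2 * (L * c) + 8 * (8 * inp.B₀' * (5 * (d : ℝ) * L * B₈) * (α₀ + α'')) with hK
    have hcKle : c ≤ K := hcK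
    have hc0 : 0 ≤ c := hcs0
    have hC : (16 : ℝ) * (131072 * ((d : ℝ) + 1) ^ 2) * (L : ℝ) ^ 2 = 2097152 * ((d : ℝ) + 1) ^ 2 * (L : ℝ) ^ 2 := by ring
    have hC₂' : C₂ ≤ 16 * (131072 * ((d : ℝ) + 1) ^ 2) * (L : ℝ) ^ 2 := by rw [hC]; exact hC₂
    have hmono : 2 * c ^ 2 + 20 * d * α₀ * c + 2 * C₂ * c ^ 2 ≤
        2 * K ^ 2 + 20 * d * α₀ * K + 2 * (16 * (131072 * ((d : ℝ) + 1) ^ 2) * (L : ℝ) ^ 2) * K ^ 2 := by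
      have h1 : c ^ 2 ≤ K ^ 2 := pow_le_pow_left₀ hc0 hcKle 2
      have h2 : 0 ≤ 20 * (d : ℝ) * α₀ := by positivity
      have h3 : 0 ≤ 2 * (16 * (131072 * ((d : ℝ) + 1) ^ 2) * (L : ℝ) ^ 2) := by positivity
      have h4 := mul_le_mul_of_nonneg_left hcKle h2
      have h5 := mul_le_mul_of_nonneg_left h1 h3
      have h6 : 2 * C₂ * c ^ 2 ≤ 2 * (16 * (131072 * ((d : ℝ) + 1) ^ 2) * (L : ℝ) ^ 2) * c ^ 2 :=
        mul_le_mul_of_nonneg_right (by linarith only [hC₂']) (sq_nonneg _)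
      linarith only [h1, h4, h5, h6]
    exact hmono.trans g14
  have hPair : (zdGF3P₂ 𝔸 L β len (ι i)).InAPair α₀ P.1 ((zdGF3P₂ 𝔸 L β len (ι i)).act P u) := by
    show InAk L (ι i).k (ι i).η α₀ (ι i).Ω (mulCfg (mgauge P.1.1 u.1⁻¹ P.2.1) P.1.1)
    have hui : ∀ x, u.1⁻¹ x ∈ U1 𝔸 := fun x => unitaryUnits_le_U1 ((unitaryUnits 𝔸).inv_mem (hu x))
    rw [mulCfg_eq_gaugeAct_of_mgauge_eq hW]
    exact (B8Ineq132.inAk_gaugeAct_iff L (ι i).k (ι i).η α₀ (ι i).Ω hui _).2 h34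
  have h162' : (zdGF3P₂ 𝔸 L β len (ι i)).C162 1 (5 * (d : ℝ) * L * B₈ * (α₀ + α'')) P.1 ((zdGF3P₂ 𝔸 L β len (ι i)).act P u) := by
    intro j hj b hb
    obtain ⟨h1, h2, h3⟩ := h162 j hj b hb
    exact ⟨h1, h2, by rw [one_mul]; exact h3⟩
  obtain ⟨h136, h139⟩ := H3 i α₀ α'' (5 * (d : ℝ) * L * B₈ * (α₀ + α'')) hα₀ hα₀3 hα'' hα''3 hcspos hcs3 h61 P.1
    ((zdGF3P₂ 𝔸 L β len (ι i)).act P u) hInA hReg hPair h162' hLan h137''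
  -- constants: `5dLB₀(α₀ + α″) = B₁(α₀ + α₁)`, `5dL·B₀β·(α₀ + α″) = B₂(α₀ + α₁)`
  have e1 : 5 * (d : ℝ) * (L : ℝ) * inp.B₀ * (α₀ + α'') = B₁ * (α₀ + α₁) := by
    rw [hsum, hB₁_def]; ring
  have e2 : 5 * (d : ℝ) * (L : ℝ) * B₀β * (α₀ + α'') = B₂ * (α₀ + α₁) := by rw [hsum, hB₂_def]; ring
  obtain ⟨h136a, h136g, h136h⟩ := h136
  obtain ⟨h139j, h139l⟩ := h139
  refine ⟨u, hR, ⟨⟨fun j hj b hb => ?_, by rw [← e1]; exact h136g, by rw [← e2]; exact h136h⟩, h137, hLan,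
    ⟨by rw [← e1]; exact h139j, by rw [← e1]; exact h139l⟩⟩, ?_⟩
  · obtain ⟨h1, h2, h3⟩ := h136a j hj b hb
    exact ⟨h1, h2, by rw [← e1]; exact h3⟩
  -- uniqueness: Theorem 4's, since (1.36) at `B₁(α₀ + α₁) = B₁′(α₀ + α″)` is (1.62) there and (1.37) is monotone in α₁
  · intro u' hR' h136' h137' hLan' _
    refine huniq u' hR' ?_ hLan' ?_
    · intro j hj c hc
      have hmono : 2 * (d : ℝ) * L * α₁ ≤ 2 * d * L * α'' := mul_le_mul_of_nonneg_left hα₁'' (by positivity)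
      exact (h137' j hj c hc).trans_le hmono
    · intro j hj b hb
      obtain ⟨h1, h2, h3⟩ := h136'.1 j hj b hb
      refine ⟨h1, h2, ?_⟩
      have e1' : B₁ * (α₀ + α₁) = 5 * (d : ℝ) * L * inp.B₀ * (α₀ + α'') := by rw [hsum, hB₁_def]; ring
      have hle : 5 * (d : ℝ) * L * inp.B₀ * (α₀ + α'') ≤ 5 * (d : ℝ) * L * B₈ * (α₀ + α'') := by
        have h₁ : inp.B₀ ≤ B₈ := hB₀8
        have h₂ : 0 ≤ 5 * (d : ℝ) * L := by positivity
        have h₃ : 0 ≤ α₀ + α'' := by positivity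
        exact mul_le_mul_of_nonneg_right (mul_le_mul_of_nonneg_left h₁ h₂) h₃
      have hw0 : 0 ≤ ((L : ℝ) ^ j * (ι i).η)⁻¹ := inv_nonneg.2 (mul_nonneg (pow_nonneg (Nat.cast_nonneg _) _) (ι i).hη.le)
      exact h3.trans (mul_le_mul_of_nonneg_right (e1'.le.trans hle) hw0)

end Thm2

end Literature.MathematicalPhysics.QuantumFieldTheory.Balaban1983to89.B8Thm2ZdGF3P2MapGammaPrime

end
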